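import Summits.QuantumFields.BalabanUV.Beta.GAN24.CombLegFaceSawtoothBlockL1

/-!
# `BalabanUV.Beta.GAN24.CombLegBlockL1Envelope` — binder row G-an2-4 ∕ (CONV-C), TRANSFER-III (the (III′) column of RULING R-gan24p1-g46-2), THE COMB LEG DICTIONARY, THIRD WORD:
# **THE CONJUGATED (COMB-CHART) COMPOSITE LEG FAMILIES ARE `T^B`-SIZED IN BLOCK-ℓ¹, UNIFORMLY IN THE PAIR OF LEVELS** — the (III′) twin of the OWNER's part 2
# `GAN24/DressedLegBlockL1Envelope`: `Σ_{t ∈ box (Lc^{k+1})} |legChain (j ↦ legComp ψ♭ R_j) m k μ z κ (Lc^{k+1}•c + t)| ≤ K·(k+1)·(Lc^{k+1})⁻¹·e^{−κ₀‖c − z‖∞}`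
# (OWNER `b2b-balaban-gan24-p1` gen 47; no existing file touched)

NOT IN PRINT; OUR BOOKKEEPING ([folklore] triangle inequalities BY NAME over the first word's decomposition `CombLegChainGauge.legAct_legChain_psiLeg_eq`, leaf-03 g41's
`RespStepBmDecompPsi.legAct_legChain_respStepBm`, the second word's `abs_axProjBmAt_respStep_single_le` ∕ `sum_box_abs_dz_PsiFace_single_le'`, part 1's
`DressedLegSawtoothBlockL1.sum_box_abs_dz_Psi_single_le` and leaf-12's (N1) letter `RespStepDecay.exists_respStep_decay_and_grad`; 0 `def`, 0 cited facts, 0 `def … : Prop`, 0 sorry).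
HONEST FRAMING (cell contract, verbatim): «discharging `BetaPertH` makes Bałaban's UV stability UNCONDITIONAL — a real constructive-QFT result; it is NOT the continuum limit and NOT
the Clay problem.»  HONEST DEPENDENCY (verbatim): «continuum YM on T⁴ ⇐ BetaPertH ∧ nine spine estimates (0/9 proved); BetaPertH ⇐ (D1) ∧ (D4) ∧ CAP+tail; G-an2-4 gates asym,
D1 and NE2/3/4.»

WHAT (`d = 3`, `[NeZero Lc]`, in-block roots `r` (face weights of `Ψ̂_S`, `ψ♭ α x κ u := Ψ̂_S u x (inl κ) (inl α)`) and `ρ = toSite rr` (dressing, `R_j = respStepBmSeq ρ Lc j`)):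
* §1 **`sum_box_abs_legChain_psiLeg_single_le`** — PARAMETRIC in leaf-12's (N1) data `κ₀ ≥ 0`, `C ≥ 0` (the `hN1` letter of parts 1 ∕ 2): for ALL `m k μ z κ c`,
  `Σ_{t ∈ box (Lc^{k+1})} |legChain (j ↦ legComp ψ♭ R_j) m k μ z κ (Lc^{k+1}•c + t)|
     ≤ ((1 + 8·Lc·(e^{κ₀}+1))·C + 16·k·Lc·e^{κ₀}·C + 2·(k+1)·faceWtSum r Lc·(1 + 8·Lc·(e^{κ₀}+1))·e^{κ₀}·C)·(Lc^{k+1})⁻¹·e^{−κ₀‖c − z‖∞}` —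
  the kernel entry is the conjugated chain on the point datum (`legAct_single`) = `Π^ρ_bm T^B + dz Ψ + dz PsiFace` (first word + leaf-03); the three block masses are the
  second word's §2 (pointwise, the envelope constant on the source block), part 1's §3 and the second word's §4.
* §2 **`exists_legChain_psiLeg_blockL1_envelope`** — leaf-12's rate `κ₀ > 0` and ONE `K ≥ 0`, uniform in BOTH in-block roots, with the displayed law for ALL `m k μ z κ c` —
  the statement of part 2's `exists_legChain_blockL1_envelope` VERBATIM for the conjugated legs: THE (III′) COMPOSITE LEGS MEET THE BLOCK-ℓ¹ KERNEL-LEG HYPOTHESIS `hρ` OF THE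
  (H1♮) CORE (`ThreeLegDoubleFreezeBlockL1.abs_threeLeg_blockSum_le_of_blockL1`) EXACTLY AS THE (E) LEGS DO (`faceWtSum r Lc ≤ Σ_{r′ ∈ box} faceWtSum r′ Lc` makes `K` root-free).
Asserts NOTHING about Bałaban's tables; NOT the windows L11–L13 at (III′) (they re-run BY NAME on this `hρ` — the word after), NOT a letter row; the (III′) campaign is NOT asked
(an2 W-4) — typed while idle under R-2; NEVER «G-an2-4 closed» as (CONV-C); NOT D1, NOT `BetaPertH`, NOT continuum, NOT Clay.  2026-08-25.
-/

noncomputable section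

open Finset
open scoped BigOperators
open Literature.MathematicalPhysics.QuantumFieldTheory
open Literature.MathematicalPhysics.QuantumFieldTheory.LatticeForm (quo)
open Literature.MathematicalPhysics.QuantumFieldTheory.Balaban1983to89
open Literature.MathematicalPhysics.QuantumFieldTheory.Balaban1983to89.Beta
open B4ContourShift (supNorm)
open AffineAveraging (Form0 Form1 Site box toSite unitVec dz)
open BalabanCompositeJets (respStep)
open KKTFluctuationEnergy (quo_zsmul_add_toSite)
open Summit.QuantumFields.BalabanUV.Beta.AxialProjectorBlockMean (axProjBmAt)
open Summit.QuantumFields.BalabanUV.Beta.SymCorrectorKernel (psiKS)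
open Summit.QuantumFields.BalabanUV.Beta.SymCorrectorFace (faceWtSum faceWtSum_nonneg)
open Summit.QuantumFields.BalabanUV.Beta.GAN24.Push4 (legComp)
open Summit.QuantumFields.BalabanUV.Beta.GAN24.Push4Iter (legChain)
open Summit.QuantumFields.BalabanUV.Beta.GAN24.RespStepBmDecompLegs (legAct)
open Summit.QuantumFields.BalabanUV.Beta.GAN24.RespStepBmDecompExact (respStepBmSeq)
open Summit.QuantumFields.BalabanUV.Beta.GAN24.RespStepBmDecompPsi (Psi legAct_legChain_respStepBm)
open Summit.QuantumFields.BalabanUV.Beta.GAN24.RespStepDecay (exists_respStep_decay_and_grad)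
open Summit.QuantumFields.BalabanUV.Beta.GAN24.UndressedResponseUnits (inv_cast_pow_pow)
open Summit.QuantumFields.BalabanUV.Beta.GAN24.DressedLegEnvelope (legAct_single summable_single_and_le)
open Summit.QuantumFields.BalabanUV.Beta.GAN24.DressedLegSawtoothBlockL1 (sum_box_abs_dz_Psi_single_le)
open Summit.QuantumFields.BalabanUV.Beta.GAN24.TransversalZeroMode (card_box_succ)
open Summit.QuantumFields.BalabanUV.Beta.GAN24.CombLegChainGauge (PsiFace legAct_legChain_psiLeg_eq)
open Summit.QuantumFields.BalabanUV.Beta.GAN24.CombLegFaceSawtoothBlockL1 (abs_axProjBmAt_respStep_single_le sum_box_abs_dz_PsiFace_single_le')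

namespace Summit.QuantumFields.BalabanUV.Beta.GAN24.CombLegBlockL1Envelope

section Four

variable {Lc : ℕ} [NeZero Lc]

/-! ## §1 The conjugated composite legs in block-ℓ¹, parametric in (N1) -/

/-- NOT IN PRINT; OUR BOOKKEEPING.  **THE CONJUGATED (COMB-CHART) COMPOSITE LEG FAMILIES IN BLOCK-ℓ¹, PARAMETRIC IN (N1)** (`d = 3`, in-block roots `r`, `ρ = toSite rr`;
`κ₀ ≥ 0`, `C ≥ 0`): for ALL `m k μ z κ c`,
`Σ_{t ∈ box (Lc^{k+1})} |legChain (j ↦ legComp ψ♭ R_j) m k μ z κ (Lc^{k+1}•c + t)| ≤ ((1 + 8·Lc·(e^{κ₀}+1))·C + 16·k·Lc·e^{κ₀}·C + 2·(k+1)·faceWtSum r Lc·(1 + 8·Lc·(e^{κ₀}+1))·e^{κ₀}·C)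
·(Lc^{k+1})⁻¹·e^{−κ₀‖c − z‖∞}` — entry = conjugated chain on the point datum (`legAct_single`) = `Π^ρ_bm T^B + dz Ψ + dz PsiFace` (first word `legAct_legChain_psiLeg_eq` + leaf-03's
`legAct_legChain_respStepBm`); `Π^ρ_bm T^B` pointwise (second word §2; the envelope is constant on the source block, `(Lc^{k+1})^4·(Lc^{5(k+1)})⁻¹ = (Lc^{k+1})⁻¹`), `dz Ψ` by part 1,
`dz PsiFace` by the second word. -/
theorem sum_box_abs_legChain_psiLeg_single_le {κ₀ C : ℝ} (hκ : 0 ≤ κ₀) (hC : 0 ≤ C)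
    (hN1 : ∀ (m k : ℕ) (μ : Fin (3 + 1)) (z : Site (3 + 1)) (l'' : Fin (3 + 1)) (w' : Site (3 + 1)),
      |respStep (d := 3) (Lc ^ m) (Lc ^ (m + k + 1)) μ z l'' w'| ≤
        C * ((Lc : ℝ) ^ (5 * (k + 1)))⁻¹ * Real.exp (-(κ₀ * supNorm (quo (Lc ^ (k + 1)) w' - z))))
    {r : Fin (3 + 1) → ℕ} (hr : r ∈ box (3 + 1) Lc) {rr : Fin (3 + 1) → ℕ} (hrr : rr ∈ box (3 + 1) Lc)
    (m k : ℕ) (μ : Fin (3 + 1)) (z : Site (3 + 1)) (κ : Fin (3 + 1)) (c : Site (3 + 1)) :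
    ∑ t ∈ box (3 + 1) (Lc ^ (k + 1)),
        |legChain (fun j => legComp (fun α x κ u => psiKS r Lc u x (Sum.inl κ) (Sum.inl α)) (respStepBmSeq (d := 3) (toSite rr) Lc j)) m k
          μ z κ (((Lc ^ (k + 1) : ℕ) : ℤ) • c + toSite t)|
      ≤ ((1 + 8 * (Lc : ℝ) * (Real.exp κ₀ + 1)) * C + 16 * (k : ℝ) * (Lc : ℝ) * Real.exp κ₀ * C
          + 2 * ((k : ℝ) + 1) * faceWtSum r Lc * (1 + 8 * (Lc : ℝ) * (Real.exp κ₀ + 1)) * Real.exp κ₀ * C) *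
        ((Lc : ℝ) ^ (k + 1))⁻¹ * Real.exp (-(κ₀ * supNorm (c - z))) := by
  classical
  have hL0 : (0 : ℝ) < Lc := by exact_mod_cast Nat.pos_of_ne_zero (NeZero.ne Lc)
  have hne : (Lc : ℝ) ≠ 0 := hL0.ne'
  haveI : NeZero (Lc ^ (k + 1)) := ⟨pow_ne_zero _ (NeZero.ne Lc)⟩
  obtain ⟨hsum, -⟩ := summable_single_and_le (d := 3) μ z
  set E : ℝ := Real.exp (-(κ₀ * supNorm (c - z))) with hE
  set W : ℝ := Real.exp κ₀ + 1 with hW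
  -- the label of every point of the source block
  have hlab : ∀ t ∈ box (3 + 1) (Lc ^ (k + 1)), quo (Lc ^ (k + 1)) (((Lc ^ (k + 1) : ℕ) : ℤ) • c + toSite t) = c :=
    fun t ht => quo_zsmul_add_toSite c ht
  -- pointwise: entry = Π^ρ_bm T^B + dz Ψ + dz PsiFace at the point
  have hpt : ∀ t ∈ box (3 + 1) (Lc ^ (k + 1)),
      |legChain (fun j => legComp (fun α x κ u => psiKS r Lc u x (Sum.inl κ) (Sum.inl α)) (respStepBmSeq (d := 3) (toSite rr) Lc j)) m k
          μ z κ (((Lc ^ (k + 1) : ℕ) : ℤ) • c + toSite t)|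
        ≤ (1 + 8 * (Lc : ℝ) * W) * C * ((Lc : ℝ) ^ (5 * (k + 1)))⁻¹ * E
          + |dz (Psi (toSite rr) Lc m k (fun μ' y => if μ' = μ then (if y = z then (1 : ℝ) else 0) else 0)) κ
              (((Lc ^ (k + 1) : ℕ) : ℤ) • c + toSite t)|
          + |dz (PsiFace r (toSite rr) Lc m k (fun μ' y => if μ' = μ then (if y = z then (1 : ℝ) else 0) else 0)) κ
              (((Lc ^ (k + 1) : ℕ) : ℤ) • c + toSite t)| := by
    intro t ht
    rw [← legAct_single (legChain (fun j => legComp (fun α x κ u => psiKS r Lc u x (Sum.inl κ) (Sum.inl α))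
        (respStepBmSeq (d := 3) (toSite rr) Lc j)) m k) μ z κ _,
      legAct_legChain_psiLeg_eq hr hrr k m hsum, legAct_legChain_respStepBm hrr m k hsum]
    simp only [Pi.add_apply]
    have h := abs_axProjBmAt_respStep_single_le hκ hC hN1 hrr m k μ z κ (((Lc ^ (k + 1) : ℕ) : ℤ) • c + toSite t)
    rw [hlab t ht] at h
    exact (abs_add_le _ _).trans (add_le_add ((abs_add_le _ _).trans (add_le_add h le_rfl)) le_rfl)
  refine (Finset.sum_le_sum hpt).trans ?_
  rw [Finset.sum_add_distrib, Finset.sum_add_distrib, Finset.sum_const, card_box_succ, nsmul_eq_mul]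
  have hsaw := sum_box_abs_dz_Psi_single_le (Lc := Lc) hκ hC hN1 hrr m k μ z κ c
  have hface := sum_box_abs_dz_PsiFace_single_le' (Lc := Lc) hκ hC hN1 hr hrr m k μ z κ c
  rw [← hE] at hsaw hface
  push_cast
  -- the projector part: `(Lc^{k+1})^4 · (Lc^{5(k+1)})⁻¹ = (Lc^{k+1})⁻¹`
  have hN0 : ((Lc : ℝ) ^ (k + 1)) ^ 4 ≠ 0 := pow_ne_zero _ (pow_ne_zero _ hne)
  have e5 : ((Lc : ℝ) ^ (5 * (k + 1)))⁻¹ = (((Lc : ℝ) ^ (k + 1)) ^ 4)⁻¹ * ((Lc : ℝ) ^ (k + 1))⁻¹ := by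
    rw [← mul_inv, ← pow_mul, ← pow_add]; congr 2; ring
  have hprojsum : ((Lc : ℝ) ^ (k + 1)) ^ 4 * ((1 + 8 * (Lc : ℝ) * W) * C * ((Lc : ℝ) ^ (5 * (k + 1)))⁻¹ * E)
      = (1 + 8 * (Lc : ℝ) * W) * C * ((Lc : ℝ) ^ (k + 1))⁻¹ * E := by
    rw [e5]
    calc ((Lc : ℝ) ^ (k + 1)) ^ 4 * ((1 + 8 * (Lc : ℝ) * W) * C * ((((Lc : ℝ) ^ (k + 1)) ^ 4)⁻¹ * ((Lc : ℝ) ^ (k + 1))⁻¹) * E)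
        = (1 + 8 * (Lc : ℝ) * W) * C * ((Lc : ℝ) ^ (k + 1))⁻¹ * E * (((Lc : ℝ) ^ (k + 1)) ^ 4 * (((Lc : ℝ) ^ (k + 1)) ^ 4)⁻¹) := by ring
      _ = _ := by rw [mul_inv_cancel₀ hN0, mul_one]
  rw [hprojsum]
  refine (add_le_add (add_le_add le_rfl hsaw) hface).trans (le_of_eq ?_)
  rw [hW]; ring

/-! ## §2 The (III′) kernel-leg hypothesis `hρ` in block-ℓ¹, root-free constant -/

/-- NOT IN PRINT; OUR BOOKKEEPING.  **THE CONJUGATED (COMB-CHART) COMPOSITE LEG FAMILIES ARE `T^B`-SIZED IN BLOCK-ℓ¹, UNIFORMLY IN THE PAIR OF LEVELS AND IN BOTH IN-BLOCK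
ROOTS** (`d = 3`, `[NeZero Lc]`): leaf-12's rate `κ₀ > 0` and ONE `K ≥ 0` with, for every in-block `r` (root of `Ψ̂_S`) and `rr` (root of the dressing) and ALL `m k μ z κ c`,
`Σ_{t ∈ box (Lc^{k+1})} |legChain (j ↦ legComp ψ♭ R_j) m k μ z κ (Lc^{k+1}•c + t)| ≤ K·(k+1)·(Lc^{k+1})⁻¹·e^{−κ₀‖c − z‖∞}` — part 2's `exists_legChain_blockL1_envelope` VERBATIM for
the (III′) legs (§1 at leaf-12's (N1) data; `faceWtSum r Lc ≤ Σ_{r′ ∈ box} faceWtSum r′ Lc`).  THIS is the kernel-leg hypothesis `hρ` of the (H1♮) core in block-ℓ¹ currency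
(`ThreeLegDoubleFreezeBlockL1`) for the comb-chart composite legs: the (α-0) leg-letter windows re-run on it BY NAME. -/
theorem exists_legChain_psiLeg_blockL1_envelope :
    ∃ κ₀ K : ℝ, 0 < κ₀ ∧ 0 ≤ K ∧ ∀ (r : Fin (3 + 1) → ℕ), r ∈ box (3 + 1) Lc → ∀ (rr : Fin (3 + 1) → ℕ), rr ∈ box (3 + 1) Lc →
      ∀ (m k : ℕ) (μ : Fin (3 + 1)) (z : Site (3 + 1)) (κ : Fin (3 + 1)) (c : Site (3 + 1)),
        ∑ t ∈ box (3 + 1) (Lc ^ (k + 1)),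
            |legChain (fun j => legComp (fun α x κ u => psiKS r Lc u x (Sum.inl κ) (Sum.inl α)) (respStepBmSeq (d := 3) (toSite rr) Lc j)) m k
              μ z κ (((Lc ^ (k + 1) : ℕ) : ℤ) • c + toSite t)|
          ≤ K * ((k : ℝ) + 1) * ((Lc : ℝ) ^ (k + 1))⁻¹ * Real.exp (-(κ₀ * supNorm (c - z))) := by
  classical
  obtain ⟨κ₀, C, C', hκ₀, hC, -, hN1', -⟩ := exists_respStep_decay_and_grad (Lc := Lc)
  have hN1 : ∀ (m k : ℕ) (μ : Fin (3 + 1)) (z : Site (3 + 1)) (l'' : Fin (3 + 1)) (w' : Site (3 + 1)),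
      |respStep (d := 3) (Lc ^ m) (Lc ^ (m + k + 1)) μ z l'' w'| ≤
        C * ((Lc : ℝ) ^ (5 * (k + 1)))⁻¹ * Real.exp (-(κ₀ * supNorm (quo (Lc ^ (k + 1)) w' - z))) := by
    intro m k μ z l'' w'
    have h := hN1' m k μ z l'' w'
    rwa [inv_cast_pow_pow] at h
  set W : ℝ := Real.exp κ₀ + 1 with hW
  -- a root-free majorant of the face-weight table
  set Fm : ℝ := ∑ r' ∈ box (3 + 1) Lc, faceWtSum r' Lc with hFm
  have hFm0 : 0 ≤ Fm := Finset.sum_nonneg fun r' _ => faceWtSum_nonneg r' Lc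
  have hA0 : 0 ≤ (1 + 8 * (Lc : ℝ) * W) * C := by positivity
  have hB0 : 0 ≤ 16 * (Lc : ℝ) * Real.exp κ₀ * C := by positivity
  have hD0 : 0 ≤ 2 * Fm * (1 + 8 * (Lc : ℝ) * W) * Real.exp κ₀ * C := by positivity
  refine ⟨κ₀, (1 + 8 * (Lc : ℝ) * W) * C + 16 * (Lc : ℝ) * Real.exp κ₀ * C + 2 * Fm * (1 + 8 * (Lc : ℝ) * W) * Real.exp κ₀ * C,
    hκ₀, by positivity, ?_⟩
  intro r hr rr hrr m k μ z κ c
  have hF : faceWtSum r Lc ≤ Fm := Finset.single_le_sum (fun r' _ => faceWtSum_nonneg r' Lc) hr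
  have hF0 := faceWtSum_nonneg r Lc
  refine (sum_box_abs_legChain_psiLeg_single_le hκ₀.le hC hN1 hr hrr m k μ z κ c).trans ?_
  rw [← hW]
  have hx0 : 0 ≤ ((Lc : ℝ) ^ (k + 1))⁻¹ * Real.exp (-(κ₀ * supNorm (c - z))) := by positivity
  have hk0 : (0 : ℝ) ≤ k := Nat.cast_nonneg k
  have hG0 : 0 ≤ 2 * (1 + 8 * (Lc : ℝ) * W) * Real.exp κ₀ * C := by positivity
  rw [mul_assoc _ (((Lc : ℝ) ^ (k + 1))⁻¹), mul_assoc _ (((Lc : ℝ) ^ (k + 1))⁻¹)]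
  apply mul_le_mul_of_nonneg_right _ hx0
  have h3 : 2 * ((k : ℝ) + 1) * faceWtSum r Lc * (1 + 8 * (Lc : ℝ) * W) * Real.exp κ₀ * C
      ≤ 2 * Fm * (1 + 8 * (Lc : ℝ) * W) * Real.exp κ₀ * C * ((k : ℝ) + 1) := by
    have := mul_le_mul_of_nonneg_left hF (mul_nonneg hG0 (by positivity : (0 : ℝ) ≤ (k : ℝ) + 1))
    nlinarith [this]
  nlinarith [mul_nonneg hA0 hk0, mul_nonneg hB0 hk0, hA0, hB0, h3]

end Four

end Summit.QuantumFields.BalabanUV.Beta.GAN24.CombLegBlockL1Envelope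

end
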